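import Literature.AnabelianGeometry.SemiGraphs.TemperedCompactPairUnfoldedInfiniteValence
import Literature.AnabelianGeometry.SemiGraphs.SubdivisionPathTurns
import HarnessLib

/-!
# EVERY interior vertex of a bridge geodesic between the fixed loci of two compact subgroups of
# `π₁^temp(𝒢)` lies over a base vertex of INFINITE valence; consequently the third regime of the trichotomy
# needs two ADJACENT infinite-valence base vertices, or collapses to tree distance EXACTLY two

Mochizuki, *Semi-graphs of anabelioids*, Publ. RIMS **42** (2006), §1, Lemma 1.8 (ii) p. 20, §3, Theorem 3.7
(iv) p. 41: "The maximal compact subgroups of `π₁^temp(𝒢)` are precisely the verticial subgroups. The nontrivial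
intersections of two distinct maximal compact subgroups of `π₁^temp(𝒢)` are precisely the edge-like subgroups."
[cite: MochizukiSemiAnbd2006, Thm 3.7(iv) p.41].

PROOF-ONLY tool file (abc-iut cell, layer L3, row «T37iv-S2@SPARSE-CLASS», file F8, seat abc-iut-L3-t8 gen 11;
no definition, no named fact).  Sequel to the trichotomy F1–F7 of abc-iut-L3-t8 gen 10 (canonical chart of ANY
countable `𝒢` with the hypotheses of Prop. 3.6 / Thm. 3.7).  The one-sided engine
`exists_unfolded_crossing_of_separating_vertex` of F3b applies not only at the separating vertex of F3a but at
EVERY vertex `z` of the level-`m` path from a `K₁`-fixed vertex `a₀` to a `K₂`-fixed vertex `b₀` that is fixed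
by neither subgroup:

* `SemiGraph.exists_first_step` — the first vertex step `x – β – ε – β' – z` of a path between
  distinct vertices; `SemiGraph.exists_extremal_subpath` — inside a path from an `A`-vertex to a `B`-vertex
  there is a sub-path whose ONLY `A`-vertex is its start and whose ONLY `B`-vertex is its end;
* ★ `exists_unfolded_crossing_of_mem_path` — unfolded `K₁ ⊓ K₂`-relevant crossings over EVERY such `z` at
  every deeper level; ★ `not_finite_star_of_mem_path` — for `K₁`, `K₂` compact with `K₁ ⊓ K₂ ≠ 1`, EVERY
  such `z` lies over a base vertex of INFINITE valence (F4 engine `not_finite_star_of_forall_unfolded`);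
* ★★ `exists_twoStep_or_adjacent_infinite_valence` — at a level without common fixed vertex and without bridge,
  EITHER some vertex fixed by neither subgroup is ADJACENT both to a `K₁`-fixed and to a `K₂`-fixed vertex (tree
  distance exactly two) OR the base graph `𝔾` has two ADJACENT vertices of infinite valence (the two branches of
  one closed edge abut to vertices of infinite valence — a loop at such a vertex included).

Hence for graphs in which no closed edge joins two vertices of infinite valence (every locally finite graph,
every star of finite graphs, the rayless star `𝒢⋆(p)` of abc-iut-L3-t8 gen 6–9) the third regime lives at tree
distance exactly two at every level — the input of F9 (`TemperedCompactPairSparse.lean`).  Honest framing: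
generic statements about OUR typed `π₁^temp`; nothing here bears on [IUTchIII] Cor. 3.12; no side taken;
typed ≠ proved.
-/
noncomputable section

open CategoryTheory Topology

namespace Literature.AnabelianGeometry.SemiGraphs

open SimpleGraph

universe u

namespace SemiGraph

variable {T : SemiGraph.{u}}

/-- **The first vertex step of a path between distinct vertices**: a path of the barycentric subdivision from
the vertex `x` to the vertex `y ≠ x` begins `x – β – ε – β' – z` along one edge `ε` with branches `β ≠ β'`
(`β` abutting to `x`, `β'` to `z`) and continues with a path from `z` to `y`.
[cite: MochizukiSemiAnbd2006, §1 pp.11-12] -/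
theorem exists_first_step {s t : T.Node} (γ : T.subdivision.Walk s t) {x y : T.Vertex} (hs : s = Sum.inl x)
    (ht : t = Sum.inl y) (hγ : γ.IsPath) (hxy : x ≠ y) :
    ∃ (β β' : T.Branch) (z : T.Vertex) (γ' : T.subdivision.Walk (Sum.inl z) t),
      β ≠ β' ∧ T.edgeOf β = T.edgeOf β' ∧ T.abuts β = some x ∧ T.abuts β' = some z ∧ γ'.IsPath ∧
      γ.support = [Sum.inl x, Sum.inr (Sum.inr β), Sum.inr (Sum.inl (T.edgeOf β)), Sum.inr (Sum.inr β')] ++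
        γ'.support := by
  subst hs
  cases γ with
  | nil => exact absurd (Sum.inl_injective ht) hxy
  | @cons _ s₁ _ h₁ γ₁ =>
    obtain ⟨β, hβ, rfl⟩ := (T.subdivision_adj_inl_iff x s₁).mp h₁
    rw [Walk.cons_isPath_iff] at hγ
    obtain ⟨hγ₁, hx₁⟩ := hγ
    cases γ₁ with
    | nil => exact absurd ht (by simp)
    | @cons _ s₂ _ h₂ γ₂ =>
      rw [Walk.cons_isPath_iff] at hγ₁
      obtain ⟨hγ₂, hb₂⟩ := hγ₁
      rcases (T.subdivision_adj_branch_iff β s₂).mp h₂ with rfl | ⟨v, hv, rfl⟩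
      · cases γ₂ with
        | nil => exact absurd ht (by simp)
        | @cons _ s₃ _ h₃ γ₃ =>
          rw [Walk.cons_isPath_iff] at hγ₂
          obtain ⟨hγ₃, he₃⟩ := hγ₂
          obtain ⟨β', hβ', rfl⟩ := (T.subdivision_adj_edge_iff (T.edgeOf β) s₃).mp h₃
          have hne : β ≠ β' := by
            rintro rfl
            exact hb₂ (by simp)
          cases γ₃ with
          | nil => exact absurd ht (by simp)
          | @cons _ s₄ _ h₄ γ₄ =>
            rw [Walk.cons_isPath_iff] at hγ₃
            obtain ⟨hγ₄, hb₄⟩ := hγ₃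
            rcases (T.subdivision_adj_branch_iff β' s₄).mp h₄ with rfl | ⟨z, hz, rfl⟩
            · exfalso
              apply he₃
              rw [Walk.support_cons]
              refine List.mem_cons.mpr (Or.inr ?_)
              rw [← hβ']
              exact γ₄.start_mem_support
            · exact ⟨β, β', z, γ₄, hne, hβ'.symm, hβ, hz, hγ₄, by simp [Walk.support_cons]⟩
      · exfalso
        have hvx : v = x := Option.some.inj (hv.symm.trans hβ)
        subst hvx
        exact hx₁ (by simp)

/-- **Extremal sub-paths.**  Inside a path of the barycentric subdivision from a vertex of `A` to a vertex of
`B` there is a sub-path from a vertex `x ∈ A` to a vertex `y ∈ B` whose only vertex in `A` is `x` and whose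
only vertex in `B` is `y` (cut at the last `A`-vertex, then at the first `B`-vertex).
[cite: MochizukiSemiAnbd2006, Lem. 1.8(ii) p.20] -/
theorem exists_extremal_subpath (A B : Set T.Vertex) :
    ∀ (n : ℕ) {a b : T.Vertex} (γ : T.subdivision.Walk (Sum.inl a) (Sum.inl b)),
      γ.IsPath → γ.length = n → a ∈ A → b ∈ B →
      ∃ (x y : T.Vertex) (δ : T.subdivision.Walk (Sum.inl x) (Sum.inl y)),
        x ∈ A ∧ y ∈ B ∧ δ.IsPath ∧ δ.support ⊆ γ.support ∧
        ∀ v : T.Vertex, (Sum.inl v : T.Node) ∈ δ.support → (v ∈ A → v = x) ∧ (v ∈ B → v = y) := by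
  classical
  intro n
  induction n using Nat.strong_induction_on with
  | _ n ih =>
    intro a b γ hγ hlen ha hb
    by_cases hB : ∃ b' : T.Vertex, b' ∈ B ∧ b' ≠ b ∧ (Sum.inl b' : T.Node) ∈ γ.support
    · obtain ⟨b', hb'B, hb'b, hmem⟩ := hB
      have hlt : (γ.takeUntil (Sum.inl b') hmem).length < n := by
        rw [← hlen]
        exact Walk.length_takeUntil_lt_length hmem (by simpa using hb'b)
      obtain ⟨x, y, δ, hx, hy, hδ, hsub, hext⟩ :=
        ih _ hlt (γ.takeUntil (Sum.inl b') hmem) (hγ.takeUntil hmem) rfl ha hb'B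
      exact ⟨x, y, δ, hx, hy, hδ, List.Subset.trans hsub (γ.support_takeUntil_subset_support hmem), hext⟩
    by_cases hA : ∃ a' : T.Vertex, a' ∈ A ∧ a' ≠ a ∧ (Sum.inl a' : T.Node) ∈ γ.support
    · obtain ⟨a', ha'A, ha'a, hmem⟩ := hA
      have hmem' : (Sum.inl a' : T.Node) ∈ γ.reverse.support := by
        rw [Walk.support_reverse, List.mem_reverse]; exact hmem
      have hlt : (γ.reverse.takeUntil (Sum.inl a') hmem').reverse.length < n := by
        rw [Walk.length_reverse, ← hlen, ← Walk.length_reverse γ]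
        exact Walk.length_takeUntil_lt_length hmem' (by simpa using ha'a)
      obtain ⟨x, y, δ, hx, hy, hδ, hsub, hext⟩ :=
        ih _ hlt (γ.reverse.takeUntil (Sum.inl a') hmem').reverse (hγ.reverse.takeUntil hmem').reverse rfl
          ha'A hb
      refine ⟨x, y, δ, hx, hy, hδ, List.Subset.trans hsub ?_, hext⟩
      intro s hs
      rw [Walk.support_reverse, List.mem_reverse] at hs
      have hs' := γ.reverse.support_takeUntil_subset_support hmem' hs
      rwa [Walk.support_reverse, List.mem_reverse] at hs'
    · push Not at hA hB
      refine ⟨a, b, γ, ha, hb, hγ, List.Subset.refl _, fun v hv => ⟨fun hvA => ?_, fun hvB => ?_⟩⟩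
      · by_contra hne
        exact hA v hvA hne hv
      · by_contra hne
        exact hB v hvB hne hv

end SemiGraph

namespace ProfiniteSemiGraph

variable {𝒢 : ProfiniteSemiGraph.{u}}

/-! ### ★ Unfolded crossings over EVERY interior vertex of a bridge path -/

/-- ★ **Unfolded crossings over every vertex of the path fixed by neither subgroup.**  Let `K₁` fix `a₀` and
`K₂` fix `b₀` in `𝒢_{∞,m}`, and let `z` be a vertex ON THE PATH from `a₀` to `b₀` fixed by NEITHER `K₁` NOR
`K₂`.  Then at every level `M ≥ m` every walk of `𝒢_{∞,M}` from a `K₁`-fixed to a `K₂`-fixed vertex contains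
a vertex `w̃` over `z` and two of its branches on the walk whose images in `𝒢_{∞,m}` are DISTINCT branches at
`z` (the one-sided engine of F3b: every `K₁`-fixed vertex reaches `a₀` along a `K₁`-fixed path, which avoids
`z`; every walk from a `K₂`-fixed vertex `b` to `a₀`, prolonged by the `K₂`-fixed path from `b₀` to `b`, is a
walk from `b₀` to `a₀`, hence passes every node of the path — abc-iut-f-172's `SemiGraph.mem_support_of_mem_support_path` — in
particular `z`, and not inside the `K₂`-fixed prefix). [cite: MochizukiSemiAnbd2006, Lem. 1.8(ii) p.20] -/
theorem exists_unfolded_crossing_of_mem_path (h36 : 𝒢.Prop36Hypotheses)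
    (K₁ K₂ : Subgroup ((𝒢.galoisLevelData h36).temperedPi h36.isCountable)) (m : ℕ)
    {a₀ b₀ : ((𝒢.galoisLevelData h36).tree m).Vertex}
    (ha₀ : ∀ k ∈ K₁, ((𝒢.galoisLevelData h36).treeAct h36.isCountable m k).hom.vertexMap a₀ = a₀)
    (hb₀ : ∀ k ∈ K₂, ((𝒢.galoisLevelData h36).treeAct h36.isCountable m k).hom.vertexMap b₀ = b₀)
    (p : ((𝒢.galoisLevelData h36).tree m).subdivision.Walk (Sum.inl a₀) (Sum.inl b₀)) (hp : p.IsPath)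
    (z : ((𝒢.galoisLevelData h36).tree m).Vertex)
    (hz : (Sum.inl z : ((𝒢.galoisLevelData h36).tree m).Node) ∈ p.support)
    (hz₁ : ¬ ∀ k ∈ K₁, ((𝒢.galoisLevelData h36).treeAct h36.isCountable m k).hom.vertexMap z = z)
    (hz₂ : ¬ ∀ k ∈ K₂, ((𝒢.galoisLevelData h36).treeAct h36.isCountable m k).hom.vertexMap z = z)
    (M : ℕ) (hmM : m ≤ M) {v u : ((𝒢.galoisLevelData h36).tree M).Vertex}
    (hv : ∀ k ∈ K₁, ((𝒢.galoisLevelData h36).treeAct h36.isCountable M k).hom.vertexMap v = v)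
    (hu : ∀ k ∈ K₂, ((𝒢.galoisLevelData h36).treeAct h36.isCountable M k).hom.vertexMap u = u)
    (γ : ((𝒢.galoisLevelData h36).tree M).subdivision.Walk (Sum.inl v) (Sum.inl u)) :
    ∃ (w : ((𝒢.galoisLevelData h36).tree M).Vertex) (β β' : ((𝒢.galoisLevelData h36).tree M).Branch),
      (Sum.inl w : ((𝒢.galoisLevelData h36).tree M).Node) ∈ γ.support ∧
      (Sum.inr (Sum.inr β) : ((𝒢.galoisLevelData h36).tree M).Node) ∈ γ.support ∧
      (Sum.inr (Sum.inr β') : ((𝒢.galoisLevelData h36).tree M).Node) ∈ γ.support ∧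
      ((𝒢.galoisLevelData h36).tree M).abuts β = some w ∧ ((𝒢.galoisLevelData h36).tree M).abuts β' = some w ∧
      ((𝒢.galoisLevelData h36).treeTrans hmM).vertexMap w = z ∧
      ((𝒢.galoisLevelData h36).treeTrans hmM).branchMap β ≠ ((𝒢.galoisLevelData h36).treeTrans hmM).branchMap β' := by
  classical
  let Dg := 𝒢.galoisLevelData h36
  have hc := h36.isCountable
  let T := Dg.tree m
  have hT := (Dg.isTree_tree m).isTree
  refine exists_unfolded_crossing_of_separating_vertex h36 K₁ K₂ m z a₀ hz₂ ?_ ?_ M hmM hv hu γ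
  · -- every walk from a `K₂`-fixed vertex to `a₀` passes `z`
    intro b hb q
    obtain ⟨r, hrp, -⟩ := (hT.connected (Sum.inl b₀ : T.Node) (Sum.inl b)).exists_path_of_dist
    have hzr : (Sum.inl z : T.Node) ∉ r.support := fun hmem =>
      hz₂ fun k hk => (fixes_of_mem_support_path h36 m k (hb₀ k hk) (hb k hk) r hrp).1 z hmem
    have hzp : (Sum.inl z : T.Node) ∈ p.reverse.support := by
      rw [Walk.support_reverse, List.mem_reverse]; exact hz
    have hmem : (Sum.inl z : T.Node) ∈ (r.append q).support :=
      SemiGraph.mem_support_of_mem_support_path hT.isAcyclic p.reverse hp.reverse hzp (r.append q)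
    rw [Walk.mem_support_append_iff] at hmem
    exact hmem.resolve_left hzr
  · -- every `K₁`-fixed vertex reaches `a₀` avoiding `z`
    intro a ha
    obtain ⟨r, hrp, -⟩ := (hT.connected (Sum.inl a : T.Node) (Sum.inl a₀)).exists_path_of_dist
    exact ⟨r, fun hmem => hz₁ fun k hk => (fixes_of_mem_support_path h36 m k (ha k hk) (ha₀ k hk) r hrp).1 z hmem⟩

/-! ### ★ Every such vertex lies over a base vertex of infinite valence -/

/-- ★ **EVERY interior vertex of a bridge path lies over a base vertex of INFINITE valence.**  Let `𝒢` satisfy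
the hypotheses of Thm 3.7, `K₁, K₂ ≤ π₁^temp(𝒢)` be COMPACT with `K₁ ⊓ K₂ ≠ 1`, `K₁` fixing `a₀` and `K₂`
fixing `b₀` in `𝒢_{∞,m}`.  Then every vertex `z` of the path from `a₀` to `b₀` fixed by NEITHER subgroup lies
over a base vertex with infinitely many branches: by `exists_unfolded_crossing_of_mem_path` every level
`M ≥ m` carries an unfolded `K₁ ⊓ K₂`-fixed branch pair over `z` (on the geodesic between a `K₁`-fixed and a
`K₂`-fixed vertex of `𝒢_{∞,M}`), and F4's `not_finite_star_of_forall_unfolded` applies.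
[cite: MochizukiSemiAnbd2006, Thm 3.7(iv) p.41] -/
theorem not_finite_star_of_mem_path (h37 : 𝒢.Thm37Hypotheses)
    (K₁ K₂ : Subgroup ((𝒢.galoisLevelData h37.toProp36Hypotheses).temperedPi h37.toProp36Hypotheses.isCountable))
    (hK₁ : IsCompact (K₁ : Set ((𝒢.galoisLevelData h37.toProp36Hypotheses).temperedPi
      h37.toProp36Hypotheses.isCountable)))
    (hK₂ : IsCompact (K₂ : Set ((𝒢.galoisLevelData h37.toProp36Hypotheses).temperedPi
      h37.toProp36Hypotheses.isCountable)))
    (hne : K₁ ⊓ K₂ ≠ ⊥) (m : ℕ)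
    {a₀ b₀ : ((𝒢.galoisLevelData h37.toProp36Hypotheses).tree m).Vertex}
    (ha₀ : ∀ k ∈ K₁, ((𝒢.galoisLevelData h37.toProp36Hypotheses).treeAct h37.toProp36Hypotheses.isCountable m
      k).hom.vertexMap a₀ = a₀)
    (hb₀ : ∀ k ∈ K₂, ((𝒢.galoisLevelData h37.toProp36Hypotheses).treeAct h37.toProp36Hypotheses.isCountable m
      k).hom.vertexMap b₀ = b₀)
    (p : ((𝒢.galoisLevelData h37.toProp36Hypotheses).tree m).subdivision.Walk (Sum.inl a₀) (Sum.inl b₀))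
    (hp : p.IsPath) (z : ((𝒢.galoisLevelData h37.toProp36Hypotheses).tree m).Vertex)
    (hz : (Sum.inl z : ((𝒢.galoisLevelData h37.toProp36Hypotheses).tree m).Node) ∈ p.support)
    (hz₁ : ¬ ∀ k ∈ K₁, ((𝒢.galoisLevelData h37.toProp36Hypotheses).treeAct h37.toProp36Hypotheses.isCountable m
      k).hom.vertexMap z = z)
    (hz₂ : ¬ ∀ k ∈ K₂, ((𝒢.galoisLevelData h37.toProp36Hypotheses).treeAct h37.toProp36Hypotheses.isCountable m
      k).hom.vertexMap z = z) :
    ¬ {b : 𝒢.graph.Branch | 𝒢.graph.abuts b =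
        some (((𝒢.galoisLevelData h37.toProp36Hypotheses).treeProj m).vertexMap z)}.Finite := by
  classical
  have h36 := h37.toProp36Hypotheses
  let Dg := 𝒢.galoisLevelData h36
  have hc := h36.isCountable
  let D₀ : VerticialLevelData.{0} 𝒢 (𝒢.temperedPiChart h36) := verticialLevelData_temperedPiChart (h36 := h36)
  haveI : T2Space (Dg.temperedPi hc) := Dg.t2Space_temperedPi hc
  have hCc : IsCompact ((K₁ ⊓ K₂ : Subgroup _) : Set (Dg.temperedPi hc)) := by
    rw [Subgroup.coe_inf]
    exact hK₁.inter_right hK₂.isClosed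
  refine not_finite_star_of_forall_unfolded h37 (K₁ ⊓ K₂) hCc hne m z fun M hM => ?_
  obtain ⟨v, hv⟩ := D₀.exists_forall_mem_fixed_vertex_of_isCompact K₁ hK₁ M
  obtain ⟨u, hu⟩ := D₀.exists_forall_mem_fixed_vertex_of_isCompact K₂ hK₂ M
  obtain ⟨γ, hγp, -⟩ := ((Dg.isTree_tree M).isTree.connected
    (Sum.inl v : (Dg.tree M).Node) (Sum.inl u)).exists_path_of_dist
  obtain ⟨w, β, β', hw, hβ, hβ', hβw, hβ'w, hwz, hne'⟩ :=
    exists_unfolded_crossing_of_mem_path h36 K₁ K₂ m ha₀ hb₀ p hp z hz hz₁ hz₂ M hM hv hu γ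
  refine ⟨w, β, β', hβw, hβ'w, hwz, hne', fun d hd => ?_⟩
  obtain ⟨hd₁, hd₂⟩ := Subgroup.mem_inf.mp hd
  obtain ⟨hfixV, hfixB⟩ := fixes_of_mem_support_path h36 M d (hv d hd₁) (hu d hd₂) γ hγp
  exact ⟨hfixV w hw, hfixB β hβ, hfixB β' hβ'⟩

/-! ### ★★ Distance exactly two, or two adjacent base vertices of infinite valence -/

/-- ★★ **At a level without common fixed vertex and without bridge: tree distance EXACTLY TWO, or two ADJACENT
infinite-valence base vertices.**  Let `𝒢` satisfy the hypotheses of Thm 3.7 and `K₁, K₂ ≤ π₁^temp(𝒢)` be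
COMPACT with `K₁ ⊓ K₂ ≠ 1`; suppose `K₁`, `K₂` fix no common vertex of `𝒢_{∞,M}` and `𝒢_{∞,M}` carries no
bridge.  Then EITHER there is a vertex `z` of `𝒢_{∞,M}` fixed by NEITHER subgroup, lying over a base vertex
of INFINITE valence, ADJACENT both to a `K₁`-fixed vertex `x` (along an edge with branches `β₁ ≠ β₁'`) and to
a `K₂`-fixed vertex `y` (along an edge with branches `β₂ ≠ β₂'`), OR the base graph `𝔾` has a closed edge
both of whose branches abut to vertices of INFINITE valence (cut the geodesic between a `K₁`-fixed and a
`K₂`-fixed vertex at its last `K₁`-fixed and then first `K₂`-fixed vertex; its first two interior vertices, if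
there are two, are adjacent and both over infinite valence by `not_finite_star_of_mem_path`).
[cite: MochizukiSemiAnbd2006, Thm 3.7(iv) p.41] -/
theorem exists_twoStep_or_adjacent_infinite_valence (h37 : 𝒢.Thm37Hypotheses)
    (K₁ K₂ : Subgroup ((𝒢.galoisLevelData h37.toProp36Hypotheses).temperedPi h37.toProp36Hypotheses.isCountable))
    (hK₁ : IsCompact (K₁ : Set ((𝒢.galoisLevelData h37.toProp36Hypotheses).temperedPi
      h37.toProp36Hypotheses.isCountable)))
    (hK₂ : IsCompact (K₂ : Set ((𝒢.galoisLevelData h37.toProp36Hypotheses).temperedPi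
      h37.toProp36Hypotheses.isCountable)))
    (hne : K₁ ⊓ K₂ ≠ ⊥) (M : ℕ)
    (hno : ∀ z : ((𝒢.galoisLevelData h37.toProp36Hypotheses).tree M).Vertex,
      (∀ k ∈ K₁, ((𝒢.galoisLevelData h37.toProp36Hypotheses).treeAct h37.toProp36Hypotheses.isCountable M
        k).hom.vertexMap z = z) →
        ¬ ∀ k ∈ K₂, ((𝒢.galoisLevelData h37.toProp36Hypotheses).treeAct h37.toProp36Hypotheses.isCountable M
          k).hom.vertexMap z = z)
    (hnobr : ¬ ∃ (x y : ((𝒢.galoisLevelData h37.toProp36Hypotheses).tree M).Vertex)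
        (β₁ β₂ : ((𝒢.galoisLevelData h37.toProp36Hypotheses).tree M).Branch),
      β₁ ≠ β₂ ∧ ((𝒢.galoisLevelData h37.toProp36Hypotheses).tree M).edgeOf β₁ =
        ((𝒢.galoisLevelData h37.toProp36Hypotheses).tree M).edgeOf β₂ ∧
      ((𝒢.galoisLevelData h37.toProp36Hypotheses).tree M).abuts β₁ = some x ∧
      ((𝒢.galoisLevelData h37.toProp36Hypotheses).tree M).abuts β₂ = some y ∧
      (∀ k ∈ K₁, ((𝒢.galoisLevelData h37.toProp36Hypotheses).treeAct h37.toProp36Hypotheses.isCountable M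
        k).hom.vertexMap x = x) ∧
      ∀ k ∈ K₂, ((𝒢.galoisLevelData h37.toProp36Hypotheses).treeAct h37.toProp36Hypotheses.isCountable M
        k).hom.vertexMap y = y) :
    (∃ (x z y : ((𝒢.galoisLevelData h37.toProp36Hypotheses).tree M).Vertex)
        (β₁ β₁' β₂ β₂' : ((𝒢.galoisLevelData h37.toProp36Hypotheses).tree M).Branch),
      β₁ ≠ β₁' ∧ ((𝒢.galoisLevelData h37.toProp36Hypotheses).tree M).edgeOf β₁ =
        ((𝒢.galoisLevelData h37.toProp36Hypotheses).tree M).edgeOf β₁' ∧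
      ((𝒢.galoisLevelData h37.toProp36Hypotheses).tree M).abuts β₁ = some x ∧
      ((𝒢.galoisLevelData h37.toProp36Hypotheses).tree M).abuts β₁' = some z ∧
      β₂ ≠ β₂' ∧ ((𝒢.galoisLevelData h37.toProp36Hypotheses).tree M).edgeOf β₂ =
        ((𝒢.galoisLevelData h37.toProp36Hypotheses).tree M).edgeOf β₂' ∧
      ((𝒢.galoisLevelData h37.toProp36Hypotheses).tree M).abuts β₂ = some z ∧
      ((𝒢.galoisLevelData h37.toProp36Hypotheses).tree M).abuts β₂' = some y ∧
      (∀ k ∈ K₁, ((𝒢.galoisLevelData h37.toProp36Hypotheses).treeAct h37.toProp36Hypotheses.isCountable M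
        k).hom.vertexMap x = x) ∧
      (∀ k ∈ K₂, ((𝒢.galoisLevelData h37.toProp36Hypotheses).treeAct h37.toProp36Hypotheses.isCountable M
        k).hom.vertexMap y = y) ∧
      (¬ ∀ k ∈ K₁, ((𝒢.galoisLevelData h37.toProp36Hypotheses).treeAct h37.toProp36Hypotheses.isCountable M
        k).hom.vertexMap z = z) ∧
      (¬ ∀ k ∈ K₂, ((𝒢.galoisLevelData h37.toProp36Hypotheses).treeAct h37.toProp36Hypotheses.isCountable M
        k).hom.vertexMap z = z) ∧
      ¬ {b : 𝒢.graph.Branch | 𝒢.graph.abuts b =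
          some (((𝒢.galoisLevelData h37.toProp36Hypotheses).treeProj M).vertexMap z)}.Finite) ∨
    ∃ (b b' : 𝒢.graph.Branch) (v v' : 𝒢.graph.Vertex), b ≠ b' ∧ 𝒢.graph.edgeOf b = 𝒢.graph.edgeOf b' ∧
      𝒢.graph.abuts b = some v ∧ 𝒢.graph.abuts b' = some v' ∧
      ¬ {c : 𝒢.graph.Branch | 𝒢.graph.abuts c = some v}.Finite ∧
      ¬ {c : 𝒢.graph.Branch | 𝒢.graph.abuts c = some v'}.Finite := by
  classical
  have h36 := h37.toProp36Hypotheses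
  let Dg := 𝒢.galoisLevelData h36
  have hc := h36.isCountable
  let D₀ : VerticialLevelData.{0} 𝒢 (𝒢.temperedPiChart h36) := verticialLevelData_temperedPiChart (h36 := h36)
  let T := Dg.tree M
  have hT := (Dg.isTree_tree M).isTree
  -- the fixed loci and a path between them, cut down to an extremal sub-path `δ : x ⟶ y`
  let A : Set T.Vertex := {a | ∀ k ∈ K₁, (Dg.treeAct hc M k).hom.vertexMap a = a}
  let B : Set T.Vertex := {b | ∀ k ∈ K₂, (Dg.treeAct hc M k).hom.vertexMap b = b}
  obtain ⟨a₀, ha₀⟩ := D₀.exists_forall_mem_fixed_vertex_of_isCompact K₁ hK₁ M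
  obtain ⟨b₀, hb₀⟩ := D₀.exists_forall_mem_fixed_vertex_of_isCompact K₂ hK₂ M
  obtain ⟨γ₀, hγ₀, -⟩ := (hT.connected (Sum.inl a₀ : T.Node) (Sum.inl b₀)).exists_path_of_dist
  obtain ⟨x, y, δ, hxA, hyB, hδ, -, hext⟩ :=
    SemiGraph.exists_extremal_subpath A B γ₀.length γ₀ hγ₀ rfl ha₀ hb₀
  have hxy : x ≠ y := fun h => hno x hxA (h ▸ hyB)
  -- first step `x – β₁ – ε₁ – β₁' – z`
  obtain ⟨β₁, β₁', z, δ₁, h11, he₁, hβ₁x, hβ₁'z, hδ₁, hsupp₁⟩ :=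
    SemiGraph.exists_first_step δ rfl rfl hδ hxy
  have hzδ : (Sum.inl z : T.Node) ∈ δ.support := by
    rw [hsupp₁]; exact List.mem_append_right _ δ₁.start_mem_support
  have hδ₁sub : δ₁.support ⊆ δ.support := by
    rw [hsupp₁]; exact List.subset_append_right _ _
  have hxδ₁ : (Sum.inl x : T.Node) ∉ δ₁.support := by
    have hnd : δ.support.Nodup := (Walk.isPath_def δ).mp hδ
    rw [hsupp₁] at hnd
    exact fun h => (List.disjoint_of_nodup_append hnd) (by simp) h
  have hzx : z ≠ x := fun h => hxδ₁ (h ▸ δ₁.start_mem_support)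
  have hzA : z ∉ A := fun h => hzx ((hext z hzδ).1 h)
  have hzy : z ≠ y := by
    intro h
    subst h
    exact hnobr ⟨x, z, β₁, β₁', h11, he₁, hβ₁x, hβ₁'z, hxA, hyB⟩
  have hzB : z ∉ B := fun h => hzy ((hext z hzδ).2 h)
  have hzinf : ¬ {b : 𝒢.graph.Branch | 𝒢.graph.abuts b = some ((Dg.treeProj M).vertexMap z)}.Finite :=
    not_finite_star_of_mem_path h37 K₁ K₂ hK₁ hK₂ hne M hxA hyB δ hδ z hzδ hzA hzB
  -- second step `z – β₂ – ε₂ – β₂' – z'`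
  obtain ⟨β₂, β₂', z', δ₂, h22, he₂, hβ₂z, hβ₂'z', hδ₂, hsupp₂⟩ :=
    SemiGraph.exists_first_step δ₁ rfl rfl hδ₁ hzy
  by_cases hz'y : z' = y
  · -- distance exactly two
    subst hz'y
    exact Or.inl ⟨x, z, z', β₁, β₁', β₂, β₂', h11, he₁, hβ₁x, hβ₁'z, h22, he₂, hβ₂z, hβ₂'z', hxA, hyB, hzA, hzB,
      hzinf⟩
  · -- a second interior vertex `z'`, adjacent to `z`: two adjacent infinite-valence base vertices
    right
    have hz'δ₁ : (Sum.inl z' : T.Node) ∈ δ₁.support := by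
      rw [hsupp₂]; exact List.mem_append_right _ δ₂.start_mem_support
    have hz'δ : (Sum.inl z' : T.Node) ∈ δ.support := hδ₁sub hz'δ₁
    have hz'x : z' ≠ x := fun h => hxδ₁ (h ▸ hz'δ₁)
    have hz'A : z' ∉ A := fun h => hz'x ((hext z' hz'δ).1 h)
    have hz'B : z' ∉ B := fun h => hz'y ((hext z' hz'δ).2 h)
    have hz'inf : ¬ {b : 𝒢.graph.Branch | 𝒢.graph.abuts b = some ((Dg.treeProj M).vertexMap z')}.Finite :=
      not_finite_star_of_mem_path h37 K₁ K₂ hK₁ hK₂ hne M hxA hyB δ hδ z' hz'δ hz'A hz'B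
    refine ⟨(Dg.treeProj M).branchMap β₂, (Dg.treeProj M).branchMap β₂', (Dg.treeProj M).vertexMap z,
      (Dg.treeProj M).vertexMap z', fun h => h22 ((Dg.treeProj M).branchMap_injOn β₂ β₂' he₂ h), ?_,
      (Dg.treeProj M).abuts_branchMap β₂ z hβ₂z, (Dg.treeProj M).abuts_branchMap β₂' z' hβ₂'z', hzinf, hz'inf⟩
    rw [(Dg.treeProj M).edgeOf_branchMap, (Dg.treeProj M).edgeOf_branchMap, he₂]

end ProfiniteSemiGraph

end Literature.AnabelianGeometry.SemiGraphs

end
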